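import Summits.Ventures.HSemireg.ContractionSpanThetaBox
import HarnessLib

/-!
# Venture HSemireg — INTRINSIC form of the theta-secant factor theorem: a non-degenerate `(1,1) ⊕ (0,2)` twist
# class IS the 2-vector of an adapted Darboux basis, so `r₂ = 2·C(n,2)` / `1`, `r₁ = 2n` need no basis by value

HONEST FRAMING. Pure linear algebra continuing `ContractionSpanThetaSecantDarboux.lean` (seat p6 of the computation cell
`pub-hsemireg`). There the theta-secant numbers take a Darboux basis `b` BY VALUE (`c = Σᵢ pᵢ ∧ qᵢ`). Here:
**`exists_basis_twoVector_eq`** — if `dim V = 2·dim L`, `c ∈ span{v ∧ q : q ∈ L}` and `c` is NON-DEGENERATE on `L^⊥`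
(`ι_φ c`, `φ ∈ L^⊥`, spans `ι(L)` — the hypothesis `hnd` of `span_secant_eq`), then `c = Σᵢ pᵢ ∧ qᵢ` for SOME basis
`(p, q)` of `V` with `span{qᵢ} = L` (collect `c = Σ pᵢ ∧ qᵢ` on a basis `qᵢ` of `L`; non-degeneracy yields a dual system
`θⱼ ∈ L^⊥`, `θⱼ(pᵢ) = δᵢⱼ`, whence independence). Consequences: the numbers `2·C(n,2)` (`n ≥ 3`), `2n` (`n ≥ 2`) and the
real-carrier `contractionRank A κ = 2·C(g,2)` under the intrinsic hypotheses «`Σ κ_p = a·1 + a'·e^{c}`, `c` a non-degenerate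
twist class of `H^{0,1}`» (e.g. `c = c₁` of a principal polarisation, type `(1,1)`, BY VALUE). Nothing here is a claim about
any explicit variety; nothing here says that HC / HC_CM / HC_AV holds. Everything is PROVED; no named fact, no new definition.
References: [BourbakiAlgebre1a3] Ch. II §7 no. 5 (dual bases), Ch. III §7, §11 no. 9; [McDuffSalamon2017] Thm. 2.1.3
(symplectic bases); [BuchweitzFlenner2008HH] Prop. 6.4.4.
-/

noncomputable section

open CliffordAlgebra (contractLeft)
open ExteriorAlgebra (ι)
open Module
open Literature.AlgebraicGeometry.Motives Literature.AlgebraicGeometry.HodgeTheory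

namespace Summit.Ventures.HSemireg

namespace ContractionSpan

section Field
variable {K : Type*} [Field K] {V : Type*} [AddCommGroup V] [Module K V]

/-- `ι_θ (p ∧ q) = θ(p)·q` when `θ(q) = 0`. [cite: BourbakiAlgebre1a3, Ch. III §11 no. 9] -/
theorem contractLeft_ι_mul_ι_of_apply_eq_zero {θ : Module.Dual K V} (p : V) {q : V} (hq : θ q = 0) :
    contractLeft θ (ι K p * ι K q) = θ p • ι K q := by
  rw [CliffordAlgebra.contractLeft_ι_mul, CliffordAlgebra.contractLeft_ι, hq, map_zero, mul_zero, sub_zero]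

/-- **Collecting a twist class on a basis of `L`**: `c ∈ span{v ∧ q : q ∈ L}` is `Σᵢ pᵢ ∧ qᵢ` for the basis `(qᵢ)` of `L`
and some `pᵢ ∈ V`. [cite: BourbakiAlgebre1a3, Ch. III §7 no. 1] -/
theorem exists_eq_sum_ι_mul_ι {n : ℕ} (L : Submodule K V) (qb : Module.Basis (Fin n) K L) {c : ExteriorAlgebra K V}
    (hc : c ∈ Submodule.span K {z : ExteriorAlgebra K V | ∃ v : V, ∃ q ∈ (L : Set V), z = ι K v * ι K q}) :
    ∃ p : Fin n → V, c = ∑ i, ι K (p i) * ι K (qb i : V) := by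
  induction hc using Submodule.span_induction with
  | mem z hz =>
    obtain ⟨v, q, hq, rfl⟩ := hz
    refine ⟨fun i => qb.repr ⟨q, hq⟩ i • v, ?_⟩
    have hq' : (q : V) = ∑ i, qb.repr ⟨q, hq⟩ i • (qb i : V) := by
      have h := congrArg (Submodule.subtype L) (qb.sum_repr ⟨q, hq⟩).symm
      rw [map_sum] at h
      simpa only [Submodule.subtype_apply, map_smul] using h
    conv_lhs => rw [hq', map_sum, Finset.mul_sum]
    refine Finset.sum_congr rfl fun i _ => ?_
    rw [map_smul, map_smul, mul_smul_comm, smul_mul_assoc]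
  | zero => exact ⟨0, by simp only [Pi.zero_apply, map_zero, zero_mul, Finset.sum_const_zero]⟩
  | add x y _ _ hx hy =>
    obtain ⟨p, rfl⟩ := hx
    obtain ⟨p', rfl⟩ := hy
    refine ⟨p + p', ?_⟩
    rw [← Finset.sum_add_distrib]
    exact Finset.sum_congr rfl fun i _ => by rw [Pi.add_apply, map_add, add_mul]
  | smul r x _ hx =>
    obtain ⟨p, rfl⟩ := hx
    refine ⟨r • p, ?_⟩
    rw [Finset.smul_sum]
    exact Finset.sum_congr rfl fun i _ => by rw [Pi.smul_apply, map_smul, smul_mul_assoc]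

/-- The span of the `ι_φ c`, `φ ∈ Θ` a subspace (given as a set closed under `+`, `•`, `0`), is attained: every element is
some `ι_φ c`. Here for `Θ = L^⊥`. [cite: BourbakiAlgebre1a3, Ch. III §11 no. 9] -/
theorem exists_contractLeft_eq_of_mem_span (L : Submodule K V) (c : ExteriorAlgebra K V) {y : ExteriorAlgebra K V}
    (hy : y ∈ Submodule.span K {y : ExteriorAlgebra K V |
      ∃ φ ∈ {θ : Module.Dual K V | ∀ q ∈ L, θ q = 0}, y = contractLeft φ c}) :
    ∃ φ : Module.Dual K V, (∀ q ∈ L, φ q = 0) ∧ contractLeft φ c = y := by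
  induction hy using Submodule.span_induction with
  | mem z hz => obtain ⟨φ, hφ, rfl⟩ := hz; exact ⟨φ, hφ, rfl⟩
  | zero => exact ⟨0, fun _ _ => rfl, by rw [map_zero, LinearMap.zero_apply]⟩
  | add z w _ _ hz hw =>
    obtain ⟨φ, hφ, h1⟩ := hz
    obtain ⟨ψ, hψ, h2⟩ := hw
    exact ⟨φ + ψ, fun q hq => by rw [LinearMap.add_apply, hφ q hq, hψ q hq, add_zero],
      by rw [map_add, LinearMap.add_apply, h1, h2]⟩
  | smul r z _ hz =>
    obtain ⟨φ, hφ, h1⟩ := hz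
    exact ⟨r • φ, fun q hq => by rw [LinearMap.smul_apply, hφ q hq, smul_zero],
      by rw [map_smul, LinearMap.smul_apply, h1]⟩

/-- **A non-degenerate twist class is the 2-vector of an adapted Darboux basis.** `dim V = 2n`, `L ⊆ V` of dimension `n`,
`c ∈ span{v ∧ q : q ∈ L}` with `ι(L) ⊆ span{ι_φ c : φ ∈ L^⊥}`: then `c = Σᵢ pᵢ ∧ qᵢ` for a basis `(p₁,…,pₙ,q₁,…,qₙ)` of `V`
with `span{qᵢ} = L` (Mathlib `Basis (Fin n ⊕ Fin n)`, the tree's `ExteriorLefschetz.twoVector`).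
[cite: McDuffSalamon2017, Thm. 2.1.3] [cite: BourbakiAlgebre1a3, Ch. II §7 no. 5] -/
theorem exists_basis_twoVector_eq [FiniteDimensional K V] {n : ℕ} (hV : finrank K V = 2 * n) (L : Submodule K V)
    (hL : finrank K L = n) {c : ExteriorAlgebra K V}
    (hc : c ∈ Submodule.span K {z : ExteriorAlgebra K V | ∃ v : V, ∃ q ∈ (L : Set V), z = ι K v * ι K q})
    (hnd : ∀ q ∈ (L : Set V), ι K q ∈ Submodule.span K {y : ExteriorAlgebra K V |
      ∃ φ ∈ {θ : Module.Dual K V | ∀ q ∈ L, θ q = 0}, y = contractLeft φ c}) :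
    ∃ b : Module.Basis (Fin n ⊕ Fin n) K V,
      Submodule.span K (Set.range (⇑b ∘ Sum.inr)) = L ∧ ExteriorLefschetz.twoVector b = c := by
  let qb : Module.Basis (Fin n) K L := (Module.finBasis K L).reindex (finCongr hL)
  obtain ⟨p, hp⟩ := exists_eq_sum_ι_mul_ι L qb hc
  have hliq : LinearIndependent K (fun i => (qb i : V)) := qb.linearIndependent.map' L.subtype (Submodule.ker_subtype L)
  have hliιq : LinearIndependent K (fun i => ι K (qb i : V)) :=
    hliq.map' (ι K) (LinearMap.ker_eq_bot.mpr (ExteriorAlgebra.ι_leftInverse (R := K) (M := V)).injective)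
  -- the dual system θⱼ ∈ L^⊥, θⱼ(pᵢ) = δᵢⱼ
  have hdual : ∀ j, ∃ θ : Module.Dual K V, (∀ q ∈ L, θ q = 0) ∧ ∀ i, θ (p i) = if i = j then 1 else 0 := by
    intro j
    obtain ⟨φ, hφL, hφc⟩ := exists_contractLeft_eq_of_mem_span L c (hnd (qb j : V) (qb j).2)
    refine ⟨φ, hφL, fun i => sub_eq_zero.mp (Fintype.linearIndependent_iff.mp hliιq
      (fun i => φ (p i) - if i = j then 1 else 0) ?_ i)⟩
    rw [hp, map_sum] at hφc
    simp_rw [contractLeft_ι_mul_ι_of_apply_eq_zero _ (hφL _ (qb _).2)] at hφc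
    simp_rw [sub_smul, Finset.sum_sub_distrib, hφc, ite_smul, one_smul, zero_smul, Finset.sum_ite_eq',
      Finset.mem_univ, if_true, sub_self]
  choose θ hθL hθp using hdual
  -- independence of (p, q)
  have hli : LinearIndependent K (Sum.elim p fun i => (qb i : V)) := by
    rw [Fintype.linearIndependent_iff]
    intro g hg
    rw [Fintype.sum_sum_type] at hg
    simp only [Sum.elim_inl, Sum.elim_inr] at hg
    have hα : ∀ j, g (Sum.inl j) = 0 := by
      intro j
      have h := congrArg (θ j) hg
      rw [map_add, map_sum, map_sum, map_zero] at h
      simp_rw [map_smul, hθp j, hθL j _ (qb _).2, smul_eq_mul, mul_ite, mul_one, mul_zero, Finset.sum_ite_eq',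
        Finset.mem_univ, if_true, Finset.sum_const_zero, add_zero] at h
      exact h
    have hβ : ∀ j, g (Sum.inr j) = 0 := by
      simp_rw [hα, zero_smul, Finset.sum_const_zero, zero_add] at hg
      exact Fintype.linearIndependent_iff.mp hliq _ hg
    rintro (j | j)
    · exact hα j
    · exact hβ j
  have hcard : Fintype.card (Fin n ⊕ Fin n) = finrank K V := by rw [Fintype.card_sum, Fintype.card_fin, hV, two_mul]
  refine ⟨basisOfLinearIndependentOfCardEqFinrank' _ hli hcard, ?_, ?_⟩
  · rw [coe_basisOfLinearIndependentOfCardEqFinrank', Sum.elim_comp_inr]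
    refine Submodule.eq_of_le_of_finrank_eq (Submodule.span_le.mpr ?_) ?_
    · rintro _ ⟨i, rfl⟩; exact (qb i).2
    · rw [finrank_span_eq_card hliq, Fintype.card_fin, hL]
  · rw [ExteriorLefschetz.twoVector, hp]
    simp only [coe_basisOfLinearIndependentOfCardEqFinrank', Sum.elim_inl, Sum.elim_inr]

variable [CharZero K]

/-- **THE THETA-SECANT FACTOR, intrinsic form, `n ≥ 3`: `r₂(a·1 + a'·e^{c}) = 2·C(n,2)`** for `dim V = 2n`, `dim L = n`,
`c` a twist class of `L` non-degenerate on `L^⊥`, `c^N = 0`, `a, a' ≠ 0`.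
[cite: BuchweitzFlenner2008HH, Prop. 6.4.4] [cite: Lange2023AbelianVarietiesComplex, §7.3.2 (1)] -/
theorem finrank_span_thetaSecant_of_nondeg [FiniteDimensional K V] {n : ℕ} (hV : finrank K V = 2 * n)
    (L : Submodule K V) (hL : finrank K L = n) {c : ExteriorAlgebra K V}
    (hc : c ∈ Submodule.span K {z : ExteriorAlgebra K V | ∃ v : V, ∃ q ∈ (L : Set V), z = ι K v * ι K q})
    (hnd : ∀ q ∈ (L : Set V), ι K q ∈ Submodule.span K {y : ExteriorAlgebra K V |
      ∃ φ ∈ {θ : Module.Dual K V | ∀ q ∈ L, θ q = 0}, y = contractLeft φ c})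
    (hn : 3 ≤ n) {N : ℕ} (hN : c ^ N = 0) {a a' : K} (ha : a ≠ 0) (ha' : a' ≠ 0) :
    finrank K (span (L : Set V) {θ : Module.Dual K V | ∀ q ∈ L, θ q = 0}
      (algebraMap K _ a + a' • ∑ k ∈ Finset.range N, ((k.factorial : K)⁻¹) • c ^ k)) = 2 * n.choose 2 := by
  obtain ⟨b, hbL, rfl⟩ := exists_basis_twoVector_eq hV L hL hc hnd
  subst hbL
  exact finrank_span_thetaSecant b hn hN ha ha'

/-- Intrinsic form, degree one, `n ≥ 2`: `r₁ = 2n`. [cite: BuchweitzFlenner2008HH, Prop. 6.4.4] -/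
theorem finrank_span₁_thetaSecant_of_nondeg [FiniteDimensional K V] {n : ℕ} (hV : finrank K V = 2 * n)
    (L : Submodule K V) (hL : finrank K L = n) {c : ExteriorAlgebra K V}
    (hc : c ∈ Submodule.span K {z : ExteriorAlgebra K V | ∃ v : V, ∃ q ∈ (L : Set V), z = ι K v * ι K q})
    (hnd : ∀ q ∈ (L : Set V), ι K q ∈ Submodule.span K {y : ExteriorAlgebra K V |
      ∃ φ ∈ {θ : Module.Dual K V | ∀ q ∈ L, θ q = 0}, y = contractLeft φ c})
    (hn : 2 ≤ n) {N : ℕ} (hN : c ^ N = 0) {a a' : K} (ha : a ≠ 0) (ha' : a' ≠ 0) :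
    finrank K (span₁ (L : Set V) {θ : Module.Dual K V | ∀ q ∈ L, θ q = 0}
      (algebraMap K _ a + a' • ∑ k ∈ Finset.range N, ((k.factorial : K)⁻¹) • c ^ k)) = 2 * n := by
  obtain ⟨b, hbL, rfl⟩ := exists_basis_twoVector_eq hV L hL hc hnd
  subst hbL
  exact finrank_span₁_thetaSecant b hn hN ha ha'

/-- Intrinsic form, `n = 2`: `r₂ = 1`. [cite: BuchweitzFlenner2008HH, Prop. 6.4.4] -/
theorem finrank_span_thetaSecant_of_nondeg_two [FiniteDimensional K V] (hV : finrank K V = 4)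
    (L : Submodule K V) (hL : finrank K L = 2) {c : ExteriorAlgebra K V}
    (hc : c ∈ Submodule.span K {z : ExteriorAlgebra K V | ∃ v : V, ∃ q ∈ (L : Set V), z = ι K v * ι K q})
    (hnd : ∀ q ∈ (L : Set V), ι K q ∈ Submodule.span K {y : ExteriorAlgebra K V |
      ∃ φ ∈ {θ : Module.Dual K V | ∀ q ∈ L, θ q = 0}, y = contractLeft φ c})
    {N : ℕ} (hN : c ^ N = 0) {a a' : K} (ha : a ≠ 0) (ha' : a' ≠ 0) :
    finrank K (span (L : Set V) {θ : Module.Dual K V | ∀ q ∈ L, θ q = 0}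
      (algebraMap K _ a + a' • ∑ k ∈ Finset.range N, ((k.factorial : K)⁻¹) • c ^ k)) = 1 := by
  obtain ⟨b, hbL, rfl⟩ := exists_basis_twoVector_eq (n := 2) hV L hL hc hnd
  subst hbL
  exact finrank_span_thetaSecant_two b hN ha ha'

end Field

end ContractionSpan

/-! ### Real carriers, intrinsic hypotheses -/

/-- **`r(A, κ) = 2·C(g, 2)`, intrinsic form (`g ≥ 3`)**: if the total class of `κ` in `Λ H¹(A)` is `a·1 + a'·e^{c}` with
`a, a' ≠ 0`, `c^N = 0`, `c ∈ span{v ∧ q : q ∈ H^{0,1}}` (type `(1,1) ⊕ (0,2)`, e.g. `c₁` of a principal polarisation) and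
`c` NON-DEGENERATE: `ι(H^{0,1}) ⊆ span{ι_θ c : θ a vector field}` — then `contractionRank A κ = 2·C(g,2)`.
[cite: BuchweitzFlenner2008HH, Prop. 6.4.4] [cite: MumfordAV1970, §1 (4) and §4 (iii)] -/
theorem contractionRank_thetaSecant_of_nondeg (A : AbelianVariety ℂ) (κ : ∀ p : ℕ, complexBetti A.X (2 * p))
    {c : ExteriorAlgebra ℂ (complexBetti A.X 1)}
    (hc : c ∈ Submodule.span ℂ {z : ExteriorAlgebra ℂ (complexBetti A.X 1) |
      ∃ v : complexBetti A.X 1, ∃ q ∈ hodgeZeroOneSet A, z = ι ℂ v * ι ℂ q})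
    (hnd : ∀ q ∈ hodgeZeroOneSet A, ι ℂ q ∈ Submodule.span ℂ {y : ExteriorAlgebra ℂ (complexBetti A.X 1) |
      ∃ φ ∈ vectorFieldSet A, y = contractLeft φ c})
    {N : ℕ} (hN : c ^ N = 0) {a a' : ℂ} (ha : a ≠ 0) (ha' : a' ≠ 0)
    (hx : totalExteriorClass A κ = algebraMap ℂ _ a + a' • ∑ k ∈ Finset.range N, ((k.factorial : ℂ)⁻¹) • c ^ k)
    (hg : 3 ≤ A.dim) : contractionRank A κ = ((2 * (A.dim).choose 2 : ℕ) : Cardinal) := by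
  have hA : IsSmoothProjective A.dim A.X := AbelianVariety.isSmoothProjective_holds
  haveI : Module.Finite ℂ (complexBetti A.X 1) := abelianVarietyCohomologyExteriorH1_holds.finite_one A
  have hV : finrank ℂ (complexBetti A.X 1) = 2 * A.dim := abelianVarietyCohomologyExteriorH1_holds.finrank_one A
  have hL : finrank ℂ (hodgeZeroOne hA) = A.dim := AbelianVariety.finrank_hodgeZeroOne_eq_dim A hA
  rw [vectorFieldSet_eq A hA rfl] at hnd
  rw [← coe_hodgeZeroOne_eq_hodgeZeroOneSet A hA rfl] at hc hnd
  obtain ⟨b, hbL, rfl⟩ := ContractionSpan.exists_basis_twoVector_eq hV (hodgeZeroOne hA) hL hc hnd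
  refine contractionRank_thetaSecant A κ b (fun i => ?_) hN ha ha' hx hg
  rw [← coe_hodgeZeroOne_eq_hodgeZeroOneSet A hA rfl, ← hbL]
  exact Submodule.subset_span ⟨i, rfl⟩

/-- **THE THETA BOX on the real carriers, intrinsic form (`dim A = 2n`, `n ≥ 3`): `contractionRank A κ = 6n² − 2n`.**
Splitting BY VALUE as in seat p4's point-pair box (`H¹(A) = V₁ ⊕ V₂`, `H^{0,1}(A) = L₁ ⊕ L₂`, `Lᵢ ⊆ Vᵢ`,
`dim Vᵢ = 2·dim Lᵢ = 2n`); the factor classes are `aᵢ·1 + aᵢ'·e^{cᵢ}` for twist classes `cᵢ ∈ Λ Vᵢ` of `Lᵢ` that are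
NON-DEGENERATE (no basis by value: `exists_basis_twoVector_eq` supplies the Darboux frames).
[cite: BuchweitzFlenner2008HH, Prop. 6.4.4] [cite: MumfordAV1970, §1 (4) and §4 (iii)] -/
theorem contractionRank_thetaBox_of_nondeg {A : AbelianVariety ℂ} (hA : IsSmoothProjective A.dim A.X)
    (κ : ∀ p : ℕ, complexBetti A.X (2 * p)) {V₁ V₂ L₁ L₂ : Submodule ℂ (complexBetti A.X 1)} {n : ℕ} (hn : 3 ≤ n)
    (hV : IsCompl V₁ V₂) (hV₁ : finrank ℂ V₁ = 2 * n) (hV₂ : finrank ℂ V₂ = 2 * n)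
    (hL : hodgeZeroOne hA = L₁ ⊔ L₂) (hL₁ : L₁ ≤ V₁) (hL₂ : L₂ ≤ V₂) (hl₁ : finrank ℂ L₁ = n) (hl₂ : finrank ℂ L₂ = n)
    {c₁ : ExteriorAlgebra ℂ V₁} {c₂ : ExteriorAlgebra ℂ V₂}
    (hc₁ : c₁ ∈ Submodule.span ℂ {z : ExteriorAlgebra ℂ V₁ |
      ∃ v : V₁, ∃ q ∈ ((L₁.comap V₁.subtype : Submodule ℂ V₁) : Set V₁), z = ι ℂ v * ι ℂ q})
    (hnd₁ : ∀ q ∈ ((L₁.comap V₁.subtype : Submodule ℂ V₁) : Set V₁), ι ℂ q ∈ Submodule.span ℂ {y : ExteriorAlgebra ℂ V₁ |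
      ∃ φ ∈ {θ : Module.Dual ℂ V₁ | ∀ q ∈ L₁.comap V₁.subtype, θ q = 0}, y = contractLeft φ c₁})
    (hc₂ : c₂ ∈ Submodule.span ℂ {z : ExteriorAlgebra ℂ V₂ |
      ∃ v : V₂, ∃ q ∈ ((L₂.comap V₂.subtype : Submodule ℂ V₂) : Set V₂), z = ι ℂ v * ι ℂ q})
    (hnd₂ : ∀ q ∈ ((L₂.comap V₂.subtype : Submodule ℂ V₂) : Set V₂), ι ℂ q ∈ Submodule.span ℂ {y : ExteriorAlgebra ℂ V₂ |
      ∃ φ ∈ {θ : Module.Dual ℂ V₂ | ∀ q ∈ L₂.comap V₂.subtype, θ q = 0}, y = contractLeft φ c₂})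
    {N₁ N₂ : ℕ} (hN₁ : c₁ ^ N₁ = 0) (hN₂ : c₂ ^ N₂ = 0)
    {a₁ a₁' a₂ a₂' : ℂ} (ha₁ : a₁ ≠ 0) (ha₁' : a₁' ≠ 0) (ha₂ : a₂ ≠ 0) (ha₂' : a₂' ≠ 0)
    (hx : totalExteriorClass A κ =
      ExteriorAlgebra.map V₁.subtype (algebraMap ℂ _ a₁ + a₁' • ∑ k ∈ Finset.range N₁, ((k.factorial : ℂ)⁻¹) • c₁ ^ k) *
        ExteriorAlgebra.map V₂.subtype (algebraMap ℂ _ a₂ + a₂' • ∑ k ∈ Finset.range N₂, ((k.factorial : ℂ)⁻¹) • c₂ ^ k)) :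
    contractionRank A κ = ((6 * n ^ 2 - 2 * n : ℕ) : Cardinal) := by
  haveI : Module.Finite ℂ (complexBetti A.X 1) := abelianVarietyCohomologyExteriorH1_holds.finite_one A
  obtain ⟨b₁, hb₁, rfl⟩ := ContractionSpan.exists_basis_twoVector_eq hV₁ (L₁.comap V₁.subtype)
    ((Submodule.comapSubtypeEquivOfLe hL₁).finrank_eq.trans hl₁) hc₁ hnd₁
  obtain ⟨b₂, hb₂, rfl⟩ := ContractionSpan.exists_basis_twoVector_eq hV₂ (L₂.comap V₂.subtype)
    ((Submodule.comapSubtypeEquivOfLe hL₂).finrank_eq.trans hl₂) hc₂ hnd₂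
  exact contractionRank_thetaBox hA κ hn hV b₁ b₂ hL hL₁ hL₂ hb₁ hb₂ hN₁ hN₂ ha₁ ha₁' ha₂ ha₂' hx

end Summit.Ventures.HSemireg

end
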